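import Summits.ABC.IUTFork.Repair.RHReqsideLabelsInd
import Literature.IUT.LogVolume.Corollary22OfThm110With
import HarnessLib

/-!
# D-0122 AXIS B, knobs k3 · k4 as specified in `REQB-SPEC` v0.2 §1/§6(b) (radius multipliers `c`, different multiplier `c_D`,
# packet collapse `(j+1) ↦ 1`, rounding `floor ↦ none`; the `l`-profile), the DOWNSTREAM conditional «modified display ⟹ abc
# with exponent `Λ`» over the tree's `Thm110LegendreWith`, and the OPENS-L-WINDOW criterion — all in the integer cell currency

abc-iut cell, rung LADDER-ABC:A2.RESCUE.H; seat abc-iut-reqb-typ-2 (second file; first = `RHReqsideLabelsInd` p505937: k2 label set, k3 as a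
monotone allowance, k5 target, pairs/triples), owner abc-iut-rh-lead g3/g4 `plan/rescue/R-H/ROUND3/REQB-SPEC.md` v0.2 (§5 «reqb-typ-2 (k3/k4:
radius multipliers, packet collapse, rounding mode, l-profile — decls + statements; the DOWNSTREAM bookkeeping «modified inequality ⟹ Szpiro-type bound
with constant u_f» typed as a conditional, hypotheses named)», §6(b) «OPENS-L-WINDOW is reqb-typ-2's column»), referee abc-iut-reqb-ref-1, engines
reqb-lp-1 / reqb-lp-2. PROOF-ONLY (0 definitions, 0 `Prop` facts).

KEY OBSERVATION (§1, `hullCellδ_scale`): the exact cell `HullCellδ e m j δ r_in r_out :⟺ e·⌊(j²m − jδ − (j+1)r_in)/e⌋ ≤ m − (j+1)r_out` is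
HOMOGENEOUS — scaling `(e, m, δ, r_in, r_out)` by a common `t > 0` leaves it unchanged. Hence every REQB-SPEC k3 setting with RATIONAL multipliers
(«floor taken AFTER multiplication», §6(b)) is LITERALLY an integer `HullCellδ` at a common denominator `N`: radius multiplier `c = a/N` and different
multiplier `c_D = a_D/N` give `HullCellδ (N·e) (N·m) j (a_D·δ) (a·r_in) (a·r_out)` (print = `a = a_D = N`, `radiusMultiplierCell_print_iff`); packet
collapse `(j+1)·R ↦ R` gives `HullCellδ ((j+1)e) ((j+1)m) j ((j+1)δ) r_in r_out` (`packetCollapseCell_print_iff`); rounding «none» is the floor-free cell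
`j²m − jδ − (j+1)r_in ≤ m − (j+1)r_out`. No new predicate is needed and the engines' integers feed `decide` rows directly.

WHAT IS PROVED (namespace `Summit.ABC.IUTFork.Repair.RH.ReqsideShellProfile`):
* §1 **k3 SIGN THEOREM.** At a place with `0 ≤ δ`, `0 ≤ R_in`, `R_out ≤ 0` (and `0 ≤ j`), every REQB-SPEC k3 point is a TIGHTENING and licenses a
  SUBSET of print's cells: `multiplierCell_le_print` (`0 ≤ a ≤ N`, `0 ≤ a_D ≤ N` jointly — singles `c ∈ {0, 1/2}`, `c_D = 0` and the pair are instances),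
  `packetCollapseCell_le_print`, `roundingNoneCell_le_print` (= rh2-w-2's floor-free half `hullCellδ_of_linear`), and compositions
  (`roundingNone_multiplierCell_le_print`); with boundaries, `sliceBoundary_le_of_imp`: `j₀(w)_mod ≤ j₀(w)`, hence `μ₄,mod ≤ μ₄`, `T_mod ≥ T` — the
  predicted word for every k3 single is «NO CHANGE» or «INCREASES», never «MEETS» unless print meets (engine A 06:36Z, all 10 single rows: FREY133 `μ₄`
  `0.524 → 0.284 (c=0) / 0.390 (c=½) / 0.226 (c_D=0) / 0.307 (packet) / 0.499 (rounding)`; HEX79 `0.840 → 0.672 / 0.711 / 0.326 / 0.687 / 0.840`). The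
  converse direction `a ≥ N` (LOOSER radii) licenses a superset (`print_le_multiplierCell_of_ge`) — the CONE-CHARGED side of REQB-SPEC §6(a)(P3). Places
  with `R_out > 0` (tame, `e_w < p − 1`, where `R_out = min_a(p^a − a·e_w) = 1`) are outside the hypotheses and must be listed by the engines.
* §2 **k4 `l`-PROFILE LAW** = the same homogeneity read on the genuine tower: `(e_w, δ_w + 1, R_in, R_out)` scale (to first order) linearly in `l` while
  `m_q = n_v/2` does not, and `HullCellδ (t·e) (t·m′) j (t·δ) (t·r_in) (t·r_out) ⟺ HullCellδ e m′ j δ r_in r_out`: raising `l` by `t` at fixed `m_q = t·m′` is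
  the cell of depth `m′ = m_q/t` — `j₀` grows like `l`, `j₀/l⋇` is `l`-free (SLICE (S1), MIN-SLICE §(v-1)); exact per-`l` values are the engines' (tabulated
  `l` only, REQB-SPEC §1 k4).
* §3 **DOWNSTREAM CONDITIONAL** (hypotheses NAMED, nothing asserted): `thm110LegendreWith_of_pointwise` — if a modified functional delivered the dilated
  display `Cor22.DisplayWith P l η (Λf l)` at every admissible `(P, l)` with `Λf l ≤ Λ`, then `Cor22.Thm110LegendreWith Λ`; hence BY NAME abc with exponent
  `Λ` on every far-from-cusps family (`abcExpOn_farFromCusps_of_pointwise`, transfer-free) and for all triples modulo `GenEll_thm21_primesWith Λ`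
  (`abcExp_of_pointwise`; R19). Instance for the k2 half-label row: the A-side factor `C(n,l)/6 = l(n+3)/((2n+5)(n−1)) ≤ 39/11` whenever `3 ≤ n`,
  `l ≤ 4n+1` (`halfTruncation_factor_le`; `C` = `ReqsideLabelsInd.decoupledConstant_eq`, print's `C(l⋇,l) > 6` = rh2-w-2 `uniformConstant_gt_six`), so
  «half label set, display granted ⟹ `Thm110LegendreWith (39/11)`» (`thm110LegendreWith_of_halfLabelDisplay`) — exponent `≤ 3.55` (exact sup `85/33` at
  `l = 13`, `→ 2`), against the licence-cut reading's `8` at `κ = 1/2` (R18): truncation changes the NORMALISATION and the ERROR side, the cut does not.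
  CAVEAT (flagged, not resolved): the `j`-free `𝔰^ℚ` term of Step (v) scales by `gap_print/gap_mod ≍ (l⋇/n)²`, `O(1/l)` of the display at print's size.
* §4 **OPENS-L-WINDOW** (REQB-SPEC §6(b)): the content cut of record is `h < 120·d*·l_A` on every tabulated row (lwin-typ-1 `lwindow_empty_all`, gap
  `≥ 7.10·10⁶`); a modification scaling the `l`-linear side by `ρ ≥ 0` keeps a row EMPTY iff `h ≤ 120·ρ·d*·l_A` (`contentCut_scaled_empty`,
  `contentCut_scaled_nonempty_iff`: opens iff `ρ < h/(120·d*·l_A) ≤ 1.41·10⁻⁷`); `decoupledConstant_anti` (`C(n,l)` antitone in `n`) gives `ρ ≥ 1` for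
  every k2 truncation — truncation NEVER opens the window (`truncation_keeps_empty`). Readings for the other knobs (engine column, not kernel): k3 radius
  multiplier `ρ = c` (only `c = 0` opens, with supply `0/133`), packet collapse `ρ = 2/(l⋇+3)`·(per-`l`), rounding `ρ = 1`, k5 `ρ = Λ₀ ≥ 1`.

HONEST FRAMING: integer/real arithmetic about OUR typed cell and the tree's named hypothesis shapes; the knob values are hypothetical modifications, not
readings of print (their CONSISTENCY is reqb-rf-1 and reqb-rf-2's column); nothing here asserts that abc is proved or refuted, that [IUTchIII] Cor. 3.12 /
[IUTchIV] Thm. 1.10 holds or fails, or takes a side on any author; typed ≠ proved; computed ≠ proved. [claim: Mochizuki2012, status: disputed] for every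
IUT locution. [cite: Mochizuki2012, IUTchIII Thm. 3.11 (i)–(iii), Cor. 3.12 p. 173–174; IUTchIV Prop. 1.2 p. 10, Prop. 1.4 p. 13, Thm. 1.10 p. 27–30,
Cor. 2.2 p. 42–46]
-/

noncomputable section

namespace Summit.ABC.IUTFork.Repair.RH.ReqsideShellProfile

open Summit.ABC.IUTFork.Repair.RH.DiffPricedHull Summit.ABC.IUTFork.Repair.RH.HullCellSlice
  Summit.ABC.IUTFork.Repair.RH.CellWeights Summit.ABC.IUTFork.Repair.RH.ReqsideLabelsInd
  Literature.IUT.LogVolume Literature.IUT.LogVolume.Cor22 Literature.NumberTheory.DiophantineGeometry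
  Literature.NumberTheory.DiophantineGeometry.GenEll

/-! ## §1. k3 as specified: multipliers, packet collapse, rounding — all integer `HullCellδ` instances -/

section Shell

/-- **HOMOGENEITY of the exact cell** (`0 < t`): `HullCellδ (t·e) (t·m) j (t·δ) (t·r_in) (t·r_out) ⟺ HullCellδ e m j δ r_in r_out`
(`⌊tX/(te)⌋ = ⌊X/e⌋`). The k3 common-denominator trick (§1) and the k4 `l`-profile law (§2) are both this identity. [folklore] -/
theorem hullCellδ_scale {t e m j δ rin rout : ℤ} (ht : 0 < t) :
    HullCellδ (t * e) (t * m) j (t * δ) (t * rin) (t * rout) ↔ HullCellδ e m j δ rin rout := by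
  unfold HullCellδ
  have hX : j ^ 2 * (t * m) - j * (t * δ) - (j + 1) * (t * rin) = t * (j ^ 2 * m - j * δ - (j + 1) * rin) := by ring
  rw [hX, Int.mul_ediv_mul_of_pos _ _ ht]
  constructor
  · intro h
    have h' : t * (e * ((j ^ 2 * m - j * δ - (j + 1) * rin) / e)) ≤ t * (m - (j + 1) * rout) := by linarith
    exact le_of_mul_le_mul_left h' ht
  · intro h
    nlinarith [mul_le_mul_of_nonneg_left h ht.le]

/-- **Print at denominator `N`**: `HullCellδ (N·e) (N·m) j (N·δ) (N·r_in) (N·r_out)` IS print's cell (`0 < N`) — the regression row of every multiplier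
setting. [folklore] -/
theorem radiusMultiplierCell_print_iff {N e m j δ rin rout : ℤ} (hN : 0 < N) :
    HullCellδ (N * e) (N * m) j (N * δ) (N * rin) (N * rout) ↔ HullCellδ e m j δ rin rout :=
  hullCellδ_scale hN

/-- **k3 MULTIPLIERS TIGHTEN** (REQB-SPEC settings `c = a/N ∈ [0,1]` on `(R_in, R_out)` jointly, `c_D = a_D/N ∈ [0,1]` on the `j·D` term; singles and the
pair): at a place with `0 ≤ δ`, `0 ≤ r_in`, `r_out ≤ 0`, label `j ≥ 0`, `0 < e`, `0 < N`, the modified cell `HullCellδ (N·e) (N·m) j (a_D·δ) (a·r_in) (a·r_out)`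
implies print's cell. (`a_D·δ ≤ N·δ`, `a·r_in ≤ N·r_in`, `N·r_out ≤ a·r_out`; then `ReqsideLabelsInd.hullCellδ_mono_shell` and homogeneity.) [folklore] -/
theorem multiplierCell_le_print {N a aD e m j δ rin rout : ℤ} (he : 0 < e) (hN : 0 < N) (hj : 0 ≤ j) (haN : a ≤ N) (haDN : aD ≤ N)
    (hδ : 0 ≤ δ) (hrin : 0 ≤ rin) (hrout : rout ≤ 0) (h : HullCellδ (N * e) (N * m) j (aD * δ) (a * rin) (a * rout)) :
    HullCellδ e m j δ rin rout :=
  (hullCellδ_scale hN).1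
    (hullCellδ_mono_shell (mul_pos hN he) hj (mul_le_mul_of_nonneg_right haDN hδ) (mul_le_mul_of_nonneg_right haN hrin)
      (mul_le_mul_of_nonpos_right haN hrout) h)

/-- **LOOSER radii license more** (`a ≥ N`, `a_D ≥ N`, same sign hypotheses): print's cell implies the modified one — the direction REQB-SPEC §6(a)(P3)
flags CONE-CHARGED (the hull volume pays for the larger container, p491009). [folklore] -/
theorem print_le_multiplierCell_of_ge {N a aD e m j δ rin rout : ℤ} (he : 0 < e) (hN : 0 < N) (hj : 0 ≤ j) (haN : N ≤ a) (haDN : N ≤ aD)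
    (hδ : 0 ≤ δ) (hrin : 0 ≤ rin) (hrout : rout ≤ 0) (h : HullCellδ e m j δ rin rout) :
    HullCellδ (N * e) (N * m) j (aD * δ) (a * rin) (a * rout) :=
  hullCellδ_mono_shell (mul_pos hN he) hj (mul_le_mul_of_nonneg_right haDN hδ) (mul_le_mul_of_nonneg_right haN hrin)
    (mul_le_mul_of_nonpos_right haN hrout) ((hullCellδ_scale hN).2 h)

/-- **Packet collapse at denominator `j+1`**: print's cell is `HullCellδ ((j+1)e) ((j+1)m) j ((j+1)δ) ((j+1)r_in) ((j+1)r_out)` (`0 ≤ j`), while the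
REQB-SPEC setting «`(j+1) ↦ 1`» (one capsule's radii instead of `j+1`) is `HullCellδ ((j+1)e) ((j+1)m) j ((j+1)δ) r_in r_out`. [folklore] -/
theorem packetCollapseCell_print_iff {e m j δ rin rout : ℤ} (hj : 0 ≤ j) :
    HullCellδ ((j + 1) * e) ((j + 1) * m) j ((j + 1) * δ) ((j + 1) * rin) ((j + 1) * rout) ↔ HullCellδ e m j δ rin rout :=
  hullCellδ_scale (by omega)

/-- **k3 PACKET COLLAPSE TIGHTENS** (`0 < e`, `0 ≤ j`, `0 ≤ r_in`, `r_out ≤ 0`): the collapsed cell implies print's. (`r_in ≤ (j+1)r_in`,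
`(j+1)r_out ≤ r_out`.) [folklore] -/
theorem packetCollapseCell_le_print {e m j δ rin rout : ℤ} (he : 0 < e) (hj : 0 ≤ j) (hrin : 0 ≤ rin) (hrout : rout ≤ 0)
    (h : HullCellδ ((j + 1) * e) ((j + 1) * m) j ((j + 1) * δ) rin rout) : HullCellδ e m j δ rin rout := by
  have h1 : rin ≤ (j + 1) * rin := le_mul_of_one_le_left hrin (by omega)
  have h2 : (j + 1) * rout ≤ rout := by nlinarith
  exact (packetCollapseCell_print_iff hj).1
    (hullCellδ_mono_shell (mul_pos (by omega) he) hj le_rfl h1 h2 h)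

/-- **k3 ROUNDING «none» TIGHTENS** (`0 < e`): the floor-free cell `j²m − jδ − (j+1)r_in ≤ m − (j+1)r_out` (REQB-SPEC «rounding none (exact rational)»)
implies print's cell — rh2-w-2's sufficient half `HullCellSlice.hullCellδ_of_linear`; the converse costs at most `e − 1` (`linear_of_hullCellδ`). [folklore] -/
theorem roundingNoneCell_le_print {e m j δ rin rout : ℤ} (he : 0 < e)
    (h : j ^ 2 * m - j * δ - (j + 1) * rin ≤ m - (j + 1) * rout) : HullCellδ e m j δ rin rout :=
  hullCellδ_of_linear he (by linarith)

/-- **Compositions tighten too**: rounding «none» on top of the multipliers (the REQB-SPEC triples' k3 coordinates) still implies print's cell under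
the sign hypotheses. [folklore] -/
theorem roundingNone_multiplierCell_le_print {N a aD e m j δ rin rout : ℤ} (he : 0 < e) (hN : 0 < N) (hj : 0 ≤ j) (haN : a ≤ N)
    (haDN : aD ≤ N) (hδ : 0 ≤ δ) (hrin : 0 ≤ rin) (hrout : rout ≤ 0)
    (h : j ^ 2 * (N * m) - j * (aD * δ) - (j + 1) * (a * rin) ≤ N * m - (j + 1) * (a * rout)) : HullCellδ e m j δ rin rout :=
  multiplierCell_le_print he hN hj haN haDN hδ hrin hrout (roundingNoneCell_le_print (mul_pos hN he) h)

/-- **BOUNDARIES FOLLOW**: if on `{1,…,L}` the modified column implies print's column pointwise, `J_mod` is a boundary of the modified column and `J` one of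
print's, then `J_mod ≤ J` — `j₀(w)_mod ≤ j₀(w)`, so `μ₄,mod ≤ μ₄` and `T_mod ≥ T` placewise and pooled (the SIGN of every k3 row). [folklore] -/
theorem sliceBoundary_le_of_imp (cellm cellp : ℤ → Prop) {L Jm J : ℤ} (hJm1 : 1 ≤ Jm) (hJmL : Jm ≤ L)
    (himp : ∀ j : ℤ, 1 ≤ j → j ≤ L → cellm j → cellp j) (hJm : ∀ j : ℤ, 1 ≤ j → j ≤ L → (cellm j ↔ j ≤ Jm))
    (hJ : ∀ j : ℤ, 1 ≤ j → j ≤ L → (cellp j ↔ j ≤ J)) : Jm ≤ J :=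
  (hJ Jm hJm1 hJmL).1 (himp Jm hJm1 hJmL ((hJm Jm hJm1 hJmL).2 le_rfl))

/-- Worked rows (HEX `λ₈@l=11`, `p = 7`: `(e,m,δ,R_in,R_out) = (165,120,164,28,−281)`, print `j₀ = 4`): `c = 1/2` (denominator `2`) keeps label `3`,
loses label `4`; `c_D = 0` keeps `3`, loses `4`; packet collapse keeps `2`, loses `3` (`j₀: 4 → 2`); rounding «none» keeps label `4` (`1124 ≤ 1525`). [folklore] -/
theorem row_hex8_l11_k3 :
    (HullCellδ (2 * 165) (2 * 120) 3 (2 * 164) (1 * 28) (1 * (-281)) ∧ ¬ HullCellδ (2 * 165) (2 * 120) 4 (2 * 164) (1 * 28) (1 * (-281))) ∧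
      (HullCellδ 165 120 3 0 28 (-281) ∧ ¬ HullCellδ 165 120 4 0 28 (-281)) ∧
        (HullCellδ ((2 + 1) * 165) ((2 + 1) * 120) 2 ((2 + 1) * 164) 28 (-281) ∧
          ¬ HullCellδ ((3 + 1) * 165) ((3 + 1) * 120) 3 ((3 + 1) * 164) 28 (-281)) ∧
          ((4 : ℤ) ^ 2 * 120 - 4 * 164 - (4 + 1) * 28 ≤ 120 - (4 + 1) * (-281)) := by
  unfold HullCellδ
  decide

end Shell

/-! ## §2. k4: the `l`-profile law is homogeneity -/

section Profile

/-- **k4 `l`-PROFILE**: scaling the local data `(e, δ, r_in, r_out)` by `t > 0` (the genuine tower: `e_w = e_v·l`, `δ_w + 1 = (δ_v+1)·l`, radii to first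
order) at FIXED depth `m_q = t·m′` is the unscaled cell at depth `m′ = m_q/t` — raising `l` acts like dividing the demand slope; with the floor-free bracket
`j₀ ≈ (δ + G)/m_q` this is `j₀ ∝ l`, `j₀/l⋇` `l`-free. (Restatement of `hullCellδ_scale` for citation in the k4 rows.) [folklore] -/
theorem lProfile_scale {t e m' j δ rin rout : ℤ} (ht : 0 < t) :
    HullCellδ (t * e) (t * m') j (t * δ) (t * rin) (t * rout) ↔ HullCellδ e m' j δ rin rout :=
  hullCellδ_scale ht

/-- **k4: at fixed depth, a scaled place licenses MORE** (`0 < e`, `1 ≤ t`, `0 ≤ j`, structural signs `0 ≤ δ`, `0 ≤ r_in`, `r_out ≤ 0`): the cell at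
`(t·e, m, t·δ, t·r_in, t·r_out)` follows from the cell at `(t·e, m, δ, r_in, r_out)` — the allowance grows with `l` while the demand does not. [folklore] -/
theorem lProfile_mono {t e m j δ rin rout : ℤ} (he : 0 < e) (ht : 1 ≤ t) (hj : 0 ≤ j) (hδ : 0 ≤ δ) (hrin : 0 ≤ rin) (hrout : rout ≤ 0)
    (h : HullCellδ (t * e) m j δ rin rout) : HullCellδ (t * e) m j (t * δ) (t * rin) (t * rout) :=
  hullCellδ_mono_shell (mul_pos (by omega) he) hj (le_mul_of_one_le_left hδ ht) (le_mul_of_one_le_left hrin ht) (by nlinarith) h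

end Profile

/-! ## §3. DOWNSTREAM: modified display ⟹ `Thm110LegendreWith Λ` ⟹ abc with exponent `Λ` (conditional, by name) -/

section Downstream

/-- **DOWNSTREAM CONDITIONAL.** If a (hypothetical) modified functional delivered, at every admissible `(P, l)` of the Cor. 2.2 proof, the dilated display
`DisplayWith P l η (Λf l)` with a per-`l` factor `Λf l ≤ Λ` (e.g. `Λf l = u_mod(l)/u(l)`, REQB-SPEC §3 DOWNSTREAM), then the tree's interface
`Thm110LegendreWith Λ` holds. HYPOTHESIS SHAPE — asserted by nobody; `DisplayWith.mono`. [claim: Mochizuki2012, status: disputed] -/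
theorem thm110LegendreWith_of_pointwise {Λf : ℕ → ℝ} {Λ : ℝ} (hΛ : ∀ l : ℕ, Λf l ≤ Λ)
    (h : ∀ η : ℝ, IsEtaPrm η → ∀ P : NFPoint, P ∈ UP → ∀ l : ℕ, l.Prime → 5 ≤ l →
      AdmitsCore P → CondP2 P l → CondP5 P l → CondP6 P l → DisplayWith P l η (Λf l)) :
    Thm110LegendreWith Λ :=
  fun η hη P hP l hl h5 hc h2 h5' h6 => (h η hη P hP l hl h5 hc h2 h5' h6).mono hη.1.le (hΛ l)

/-- **… hence abc with exponent `Λ` on every far-from-cusps family, transfer-free** (`1 ≤ Λ`; `abcExpOn_farFromCusps_of_thm110LegendreWith` BY NAME).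
Conditional on the modified display only. [claim: Mochizuki2012, status: disputed] -/
theorem abcExpOn_farFromCusps_of_pointwise {Λf : ℕ → ℝ} {Λ : ℝ} (hΛ1 : 1 ≤ Λ) (hΛ : ∀ l : ℕ, Λf l ≤ Λ)
    (h : ∀ η : ℝ, IsEtaPrm η → ∀ P : NFPoint, P ∈ UP → ∀ l : ℕ, l.Prime → 5 ≤ l →
      AdmitsCore P → CondP2 P l → CondP5 P l → CondP6 P l → DisplayWith P l η (Λf l))
    {ρ : ℝ} (h0 : 0 < ρ) (h2 : ρ ≤ 1 / 2) : ABCWithExponentOn {P : NFPoint | P.FarFromCusps {2} ρ} Λ :=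
  abcExpOn_farFromCusps_of_thm110LegendreWith hΛ1 (thm110LegendreWith_of_pointwise hΛ h) h0 h2

/-- **… and for ALL triples modulo the named open hypothesis `GenEll_thm21_primesWith Λ`** (R19: «(ii)_Λ ⇒ (i)_Λ», proved at `Λ = 1` only;
`abcExp_of_thm110LegendreWith` BY NAME). [claim: Mochizuki2012, status: disputed] -/
theorem abcExp_of_pointwise {Λf : ℕ → ℝ} {Λ : ℝ} (hΛ1 : 1 ≤ Λ) (hΛ : ∀ l : ℕ, Λf l ≤ Λ)
    (h : ∀ η : ℝ, IsEtaPrm η → ∀ P : NFPoint, P ∈ UP → ∀ l : ℕ, l.Prime → 5 ≤ l →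
      AdmitsCore P → CondP2 P l → CondP5 P l → CondP6 P l → DisplayWith P l η (Λf l))
    (hfact : GenEll_thm21_primesWith Λ) : ABCWithExponent Λ :=
  abcExp_of_thm110LegendreWith hΛ1 (thm110LegendreWith_of_pointwise hΛ h) hfact

/-- **HALF LABEL SET: the A-side factor is `≤ 39/11`.** For `3 ≤ n` and real `l ≤ 4n + 1` (every prime `l ≥ 11` with `n = ⌈l⋇/2⌉`),
`C(n,l)/6 = l(n+3)/((2n+5)(n−1)) ≤ 39/11` (equality at `n = 3`, `l = 13`); since print's `C(l⋇,l) > 6` (rh2-w-2 `uniformConstant_gt_six`) the honest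
factor `C(n,l)/C(l⋇,l)` is smaller still (exact sup `85/33`, limit `2`). [folklore] -/
theorem halfTruncation_factor_le {n : ℕ} (hn : 3 ≤ n) {l : ℝ} (hl : l ≤ 4 * n + 1) :
    l * ((n : ℝ) + 3) / ((2 * n + 5) * ((n : ℝ) - 1)) ≤ 39 / 11 := by
  have h3 : (3 : ℝ) ≤ n := by exact_mod_cast hn
  have hd : 0 < (2 * (n : ℝ) + 5) * ((n : ℝ) - 1) := by nlinarith
  rw [div_le_div_iff₀ hd (by norm_num : (0 : ℝ) < 11)]
  have h1 : l * ((n : ℝ) + 3) * 11 ≤ (4 * n + 1) * ((n : ℝ) + 3) * 11 := by nlinarith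
  nlinarith [h1, mul_nonneg (sub_nonneg.mpr h3) (show (0 : ℝ) ≤ 34 * (n : ℝ) + 76 by positivity)]

/-- **«Half label set, display granted ⟹ `Thm110LegendreWith (39/11)`»** — the k2 half row's DOWNSTREAM as ONE conditional: if at every admissible
`(P,l)` the modified display held with the A-side factor `l(n+3)/((2n+5)(n−1))` of SOME `n ≥ 3` with `l ≤ 4n+1` (the half label set), then the dilated
interface holds at `Λ = 39/11` (exponent `≤ 3.55`; R18's licence cut at `κ = 1/2` reads `8`). Hypothesis shape only. [claim: Mochizuki2012, status: disputed] -/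
theorem thm110LegendreWith_of_halfLabelDisplay
    (h : ∀ η : ℝ, IsEtaPrm η → ∀ P : NFPoint, P ∈ UP → ∀ l : ℕ, l.Prime → 5 ≤ l →
      AdmitsCore P → CondP2 P l → CondP5 P l → CondP6 P l →
        ∃ n : ℕ, 3 ≤ n ∧ (l : ℝ) ≤ 4 * n + 1 ∧ DisplayWith P l η ((l : ℝ) * ((n : ℝ) + 3) / ((2 * n + 5) * ((n : ℝ) - 1)))) :
    Thm110LegendreWith (39 / 11) := by
  intro η hη P hP l hl h5 hc h2 h5' h6
  obtain ⟨n, hn, hln, hD⟩ := h η hη P hP l hl h5 hc h2 h5' h6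
  exact hD.mono hη.1.le (halfTruncation_factor_le hn hln)

end Downstream

/-! ## §4. OPENS-L-WINDOW: the modified content cut -/

section Window

/-- **A row that is EMPTY stays EMPTY under any factor `ρ ≥ 1`**: `h < 120·d*·l_A` and `1 ≤ ρ` (with `0 ≤ 120·d*·l_A`) give `h < 120·ρ·d*·l_A`.
(lwin-typ-1 `lwindow_empty_all` supplies the premise on all 253 rows.) [folklore] -/
theorem contentCut_scaled_empty {h dstar lA ρ : ℝ} (hrow : h < 120 * dstar * lA) (hpos : 0 ≤ 120 * dstar * lA) (hρ : 1 ≤ ρ) :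
    h < 120 * ρ * dstar * lA := by
  nlinarith [mul_le_mul_of_nonneg_left hρ hpos]

/-- **The flip criterion**: with `0 < 120·d*·l_A`, the scaled cut is NON-EMPTY (`120·ρ·d*·l_A < h`) iff `ρ < h/(120·d*·l_A)` — on the bed of record
`h/(120·d*·l_A) ≤ 1/(7.10·10⁶)`, so only a modification removing essentially the whole `l`-linear side (k3 `c = 0`, supply `0/133`) opens a row.
[folklore] -/
theorem contentCut_scaled_nonempty_iff {h dstar lA ρ : ℝ} (hpos : 0 < 120 * dstar * lA) :
    120 * ρ * dstar * lA < h ↔ ρ < h / (120 * dstar * lA) := by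
  rw [lt_div_iff₀ hpos]
  constructor <;> intro H <;> nlinarith [H]

/-- **`C(n,l)` is ANTITONE in `n`** (`2 ≤ n ≤ n'`, `0 ≤ l`): iterate `ReqsideLabelsInd.decoupledConstant_succ_le`. [folklore] -/
theorem decoupledConstant_anti {n n' : ℕ} (hn : 2 ≤ n) (hnn : n ≤ n') {l : ℝ} (hl : 0 ≤ l) :
    6 * l * ((n' : ℝ) + 3) / ((2 * n' + 5) * ((n' : ℝ) - 1)) ≤ 6 * l * ((n : ℝ) + 3) / ((2 * n + 5) * ((n : ℝ) - 1)) := by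
  induction n', hnn using Nat.le_induction with
  | base => exact le_rfl
  | succ k hk ih =>
    have hstep := decoupledConstant_succ_le (le_trans hn hk) hl
    push_cast at hstep ⊢
    exact hstep.trans ih

/-- **TRUNCATION NEVER OPENS THE WINDOW**: for a truncated label set `2 ≤ n ≤ l⋇` the DOWNSTREAM factor `ρ = C(n,l)/C(l⋇,l)` is `≥ 1` (`0 ≤ l`,
`C(l⋇,l) > 0`), so by `contentCut_scaled_empty` every EMPTY row stays EMPTY. [folklore] -/
theorem truncation_keeps_empty {n ls : ℕ} (hn : 2 ≤ n) (hnl : n ≤ ls) {l : ℝ} (hl : 0 ≤ l)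
    (hCpos : 0 < 6 * l * ((ls : ℝ) + 3) / ((2 * ls + 5) * ((ls : ℝ) - 1))) {h dstar lA : ℝ} (hrow : h < 120 * dstar * lA)
    (hpos : 0 ≤ 120 * dstar * lA) :
    h < 120 * ((6 * l * ((n : ℝ) + 3) / ((2 * n + 5) * ((n : ℝ) - 1))) / (6 * l * ((ls : ℝ) + 3) / ((2 * ls + 5) * ((ls : ℝ) - 1)))) *
      dstar * lA :=
  contentCut_scaled_empty hrow hpos ((one_le_div hCpos).2 (decoupledConstant_anti hn hnl hl))

end Window

end Summit.ABC.IUTFork.Repair.RH.ReqsideShellProfile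

end
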